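import Mathlib
import Summits.KontsevichZagierPeriods.Zeta5Search.CasoratianClassBoundProof
import Summits.KontsevichZagierPeriods.Zeta5Search.PalindromicUBound
import Summits.KontsevichZagierPeriods.Zeta5Search.PalindromicWBound
import Summits.KontsevichZagierPeriods.Zeta5Search.ClassTypeGuards
import Summits.KontsevichZagierPeriods.Zeta5Search.Zeta3LawWindow
import Summits.KontsevichZagierPeriods.Zeta5Search.SingleRowLawProof
import HarnessLib

/-!
# ζ(5) search — TERMWISE bounds for the minors `Q = U W⁺ − U⁺ W` and `P̂ = U V⁺ − U⁺ V` from class data (generic in `b`)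

Cell `pub-zeta5` (HONEST FRAMING: systematic search; no irrationality claim unless certified), TRACK «DENOM-LAW» D1 prover seat
(denom-prover-d1 g12, `HOME/denom-law/prover-d1/ATTEMPT-12.md` §7).  Glue from LANDED theorems only (Theorem A/A′ for the `U`- and `W`-rows:
`padicNorm_classUsum_le_classBound` / `_le_one` (`PalindromicUBound`), `padicNorm_classW_le_classBound` / `_le_one` (`PalindromicWBound`),
the `ν`-bound `padicNorm_coeffV_le`, and the monotonicity of the class data under `b ↦ b + e_j`):
* `coeffU_norm_le` / `coeffW_norm_le`: `‖U(b)‖ ≤ p^{−u}` for any `u ≤ 0` with `u ≤ 5 + E_x` on the multipole classes, `‖W(b)‖ ≤ p^{−w}` with `3 + E_x`;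
* `minors_of_bounds`: `v_p(minorQ_j(b)) ≥ u + w`, `v_p(minorPhat_j(b)) ≥ u + v` (`v ≤ ν_x` on the pole classes) — no cancellation between the
  two products is used;
* `bounds_of_cover` / `minors_of_cover`: the same from a class-type cover and its `checkLB (A, B)` data (`u = min(0,B+2)`, `w = min(0,B)`, `v = A`);
* §2 **(QV) and (P̂V) for EVERY `b` in the regime `H(3)`** (`GoodClasses b p 3`, every multipole class `E_x ≥ −2`) — the minor analogues of the
  tree's `casoratianLaw_of_goodClasses`: `qMinorLaw_of_goodClasses` (`U`, `U⁺` are `p`-integral there and `W`, `W⁺` carry the refund by the landed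
  (WV) window theorem `zeta3CoefficientValuationLaw_window`, `lawW ≥ refund − N_p` via `topPartners_nonneg`, `refund_le_refundW`) and
  `phatMinorLaw_of_goodClasses` (THEOREM V `padicNorm_coeffV_le_pairFloors` for `V`, `V⁺`).  So, like (CV), the two minor laws need cancellation
  only in the regime `¬H(3)`.
First consumer: `FlagRayMinors` ((QV) and (P̂V) on the whole band-60 flag ray, all `n`).  `p`-adic valuations of the cell's own rationals;
the OBSERVED nodes `QMinorValuationLaw` / `PhatMinorValuationLaw` stay open for general `b`; nothing about ζ(5); no γ; records in print UNMOVED.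
-/

open Finset

namespace Summit.KontsevichZagierPeriods.Zeta5Search.ClusterValuation.MinorBounds

open Summit.KontsevichZagierPeriods.Zeta5Search.ClusterValuation
open Summit.KontsevichZagierPeriods.Zeta5Search.CasoratianValuation (InPolytope shift minorQ minorPhat refund refundW pairFloors bMin
  topPartners)
open Summit.KontsevichZagierPeriods.Zeta5Search.WedgeDictionary (coeffU coeffW coeffV dOf)
open Summit.KontsevichZagierPeriods.Zeta5Search.DualSeries (InBox)
open Summit.KontsevichZagierPeriods.Zeta5Search.PadicSeries (one_le_p zpow_p_nonneg)
open Summit.KontsevichZagierPeriods.Zeta5Search.BigPrime (shift_zero dOf_shift)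
open Summit.KontsevichZagierPeriods.Zeta5Search.ClassTypeCover
open Summit.KontsevichZagierPeriods.Zeta5Search.CellA (classW coeffW_eq_sum_classW classExp_le_classNu)

variable {p : ℕ} [hp : Fact p.Prime]

/-! ## §1 Termwise bounds for `U`, `W`, `V` and the two minors (generic in `b`) -/

/-- **`‖U(b)‖ ≤ p^{−u}`** for `u ≤ 0` with `u ≤ 5 + E_x` on every multipole class. -/
theorem coeffU_norm_le (b : ℕ → ℤ) (hb : InPolytope b) (hp5 : 5 ≤ p) (hwin : (b 0 + 2 : ℤ) < (p : ℤ) ^ 2) (u : ℤ)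
    (hu0 : u ≤ 0) (hum : ∀ x, x < p → 2 ≤ classPoleCount b p x → u ≤ 5 + classExp b p x) :
    padicNorm p (coeffU b) ≤ (p : ℚ) ^ (-u) := by
  rw [coeffU, ← sum_classSet_eq b hp.out.pos]
  refine padicNorm.sum_le' (fun x hx => ?_) (zpow_p_nonneg _)
  have hx' := mem_range.1 hx
  rcases Nat.lt_trichotomy (classPoleCount b p x) 1 with hc | hc | hc
  · rw [classUsum_eq_zero_of_noPole b hb (by omega), padicNorm.zero]; exact zpow_p_nonneg _
  · refine (padicNorm_classUsum_le_one b hb hp5 hwin hc).trans ?_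
    rw [← zpow_zero (p : ℚ)]
    exact zpow_le_zpow_right₀ one_le_p (by linarith)
  · refine (padicNorm_classUsum_le_classBound b hb hp5 hwin hx' (by omega)).trans (zpow_le_zpow_right₀ one_le_p ?_)
    have h := hum x hx' (by omega)
    unfold classBound
    rw [if_pos (by omega)]
    split_ifs <;> push_cast <;> linarith

/-- **`‖W(b)‖ ≤ p^{−w}`** for `w ≤ 0` with `w ≤ 3 + E_x` on every multipole class. -/
theorem coeffW_norm_le (b : ℕ → ℤ) (hb : InPolytope b) (hp5 : 5 ≤ p) (hwin : (b 0 + 2 : ℤ) < (p : ℤ) ^ 2) (w : ℤ)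
    (hw0 : w ≤ 0) (hwm : ∀ x, x < p → 2 ≤ classPoleCount b p x → w ≤ 3 + classExp b p x) :
    padicNorm p (coeffW b) ≤ (p : ℚ) ^ (-w) := by
  rw [coeffW_eq_sum_classW b hp.out.pos]
  refine padicNorm.sum_le' (fun x hx => ?_) (zpow_p_nonneg _)
  have hx' := mem_range.1 hx
  rcases Nat.lt_trichotomy (classPoleCount b p x) 1 with hc | hc | hc
  · rw [classW_eq_zero_of_noPole b hb (by omega), padicNorm.zero]; exact zpow_p_nonneg _
  · refine (ClusterValuation.padicNorm_classW_le_one b hb hp5 hwin hc).trans ?_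
    rw [← zpow_zero (p : ℚ)]
    exact zpow_le_zpow_right₀ one_le_p (by linarith)
  · refine (padicNorm_classW_le_classBound b hb hp5 hwin hx' (by omega)).trans (zpow_le_zpow_right₀ one_le_p ?_)
    have h := hwm x hx' (by omega)
    unfold classBound
    rw [if_pos (by omega)]
    split_ifs <;> push_cast <;> linarith

/-- The `2 × 2` minor estimate: `‖A·B' − A'·B‖ ≤ p^{−(a+c)}`. -/
theorem minor_norm_le {A A' B B' : ℚ} {a c : ℤ} (hA : padicNorm p A ≤ (p : ℚ) ^ (-a)) (hA' : padicNorm p A' ≤ (p : ℚ) ^ (-a))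
    (hB : padicNorm p B ≤ (p : ℚ) ^ (-c)) (hB' : padicNorm p B' ≤ (p : ℚ) ^ (-c)) :
    padicNorm p (A * B' - A' * B) ≤ (p : ℚ) ^ (-(a + c)) := by
  rw [show -(a + c) = -a + -c by ring]
  exact (padicNorm.sub (p := p)).trans (max_le (padicNorm_mul_le hA hB') (padicNorm_mul_le hA' hB))

/-- **The two minors from termwise bounds**: with `u ≤ 5 + E_x`, `w ≤ 3 + E_x` on the multipole classes of `b` (`u, w ≤ 0`) and `v ≤ ν_x` on its
pole classes, `v_p(minorQ_j(b)) ≥ u + w` and `v_p(minorPhat_j(b)) ≥ u + v` (the classes of `b + e_j` only improve). -/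
theorem minors_of_bounds (b : ℕ → ℤ) {j : ℕ} (hb : InPolytope b) (hj1 : 1 ≤ j) (hb' : InPolytope (shift b j)) (hp5 : 5 ≤ p)
    (hwin : (b 0 + 2 : ℤ) < (p : ℤ) ^ 2) (u w v : ℤ) (hu0 : u ≤ 0) (hw0 : w ≤ 0)
    (hum : ∀ x, x < p → 2 ≤ classPoleCount b p x → u ≤ 5 + classExp b p x)
    (hwm : ∀ x, x < p → 2 ≤ classPoleCount b p x → w ≤ 3 + classExp b p x)
    (hv : ∀ x, x < p → 1 ≤ classPoleCount b p x → v ≤ classNu b p x) :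
    (minorQ b j ≠ 0 → u + w ≤ padicValRat p (minorQ b j)) ∧
    (minorPhat b j ≠ 0 → u + v ≤ padicValRat p (minorPhat b j)) := by
  have hbox : InBox b := hb.1
  have h0' : shift b j 0 = b 0 := shift_zero b hj1
  have hwin' : (shift b j 0 + 2 : ℤ) < (p : ℤ) ^ 2 := by rw [h0']; exact hwin
  have hcnt : ∀ x, classPoleCount (shift b j) p x ≤ classPoleCount b p x := fun x => classPoleCount_shift_le b hbox hj1 p x
  have hum' : ∀ x, x < p → 2 ≤ classPoleCount (shift b j) p x → u ≤ 5 + classExp (shift b j) p x :=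
    fun x hx h2 => (hum x hx (le_trans h2 (hcnt x))).trans (by linarith [classExp_shift_ge b hbox hj1 p x])
  have hwm' : ∀ x, x < p → 2 ≤ classPoleCount (shift b j) p x → w ≤ 3 + classExp (shift b j) p x :=
    fun x hx h2 => (hwm x hx (le_trans h2 (hcnt x))).trans (by linarith [classExp_shift_ge b hbox hj1 p x])
  have hv' : ∀ x, x < p → 1 ≤ classPoleCount (shift b j) p x → v ≤ classNu (shift b j) p x :=
    fun x hx h1 => (hv x hx (le_trans h1 (hcnt x))).trans (classNu_shift_ge b hbox hj1 h1)
  have hU := coeffU_norm_le b hb hp5 hwin u hu0 hum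
  have hU' := coeffU_norm_le (shift b j) hb' hp5 hwin' u hu0 hum'
  have hW := coeffW_norm_le b hb hp5 hwin w hw0 hwm
  have hW' := coeffW_norm_le (shift b j) hb' hp5 hwin' w hw0 hwm'
  have hV := padicNorm_coeffV_le b hb hp5 hwin v hv
  have hV' := padicNorm_coeffV_le (shift b j) hb' hp5 hwin' v hv'
  refine ⟨fun hne => val_ge_of_padicNorm_le hne ?_, fun hne => val_ge_of_padicNorm_le hne ?_⟩
  · rw [minorQ]; exact minor_norm_le hU hU' hW hW'
  · rw [minorPhat]; exact minor_norm_le hU hU' hV hV'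

/-- `checkLB` data of a cover, unpacked: `A ≤ ν_x` on pole classes and `B ≤ 3 + E_x` on multipole classes. -/
theorem bounds_of_cover {b : ℕ → ℤ} {TY : List (List ℤ × Bool)} (hcov : Cover b p TY) {A B : ℤ}
    (hchk : checkLB (decide (¬ (2 : ℤ) ∣ b 0)) TY A B = true) :
    (∀ x, x < p → 1 ≤ classPoleCount b p x → A ≤ classNu b p x) ∧
    (∀ x, x < p → 2 ≤ classPoleCount b p x → B ≤ 3 + classExp b p x) := by
  rw [checkLB, List.all_eq_true] at hchk
  refine ⟨fun x hx h1 => ?_, fun x hx h2 => ?_⟩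
  · obtain ⟨tc, htc, ht⟩ := hcov x hx
    have hc := hchk tc htc
    simp only [Bool.and_eq_true, Bool.or_eq_true, decide_eq_true_eq] at hc
    rw [ht.classPoleCount_eq] at h1
    rw [ht.classNu_eq]
    rcases hc.1 with h0 | hA
    · omega
    · exact hA
  · obtain ⟨tc, htc, ht⟩ := hcov x hx
    have hc := hchk tc htc
    simp only [Bool.and_eq_true, Bool.or_eq_true, decide_eq_true_eq] at hc
    rw [ht.classPoleCount_eq] at h2
    rw [ht.classExp_eq]
    rcases hc.2 with h0 | hB
    · omega
    · exact hB

/-- **The two minors from a cover**: `v_p(minorQ_j) ≥ min(0,B+2) + min(0,B)` and `v_p(minorPhat_j) ≥ min(0,B+2) + A`. -/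
theorem minors_of_cover {b : ℕ → ℤ} {j : ℕ} (hb : InPolytope b) (hj1 : 1 ≤ j) (hb' : InPolytope (shift b j)) (hp5 : 5 ≤ p)
    (hwin : (b 0 + 2 : ℤ) < (p : ℤ) ^ 2) {TY : List (List ℤ × Bool)} (hcov : Cover b p TY) {A B : ℤ}
    (hchk : checkLB (decide (¬ (2 : ℤ) ∣ b 0)) TY A B = true) :
    (minorQ b j ≠ 0 → min 0 (B + 2) + min 0 B ≤ padicValRat p (minorQ b j)) ∧
    (minorPhat b j ≠ 0 → min 0 (B + 2) + A ≤ padicValRat p (minorPhat b j)) := by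
  obtain ⟨hA, hB⟩ := bounds_of_cover hcov hchk
  exact minors_of_bounds b hb hj1 hb' hp5 hwin (min 0 (B + 2)) (min 0 B) A (min_le_left _ _) (min_le_left _ _)
    (fun x hx h2 => by have := hB x hx h2; have := min_le_right (0 : ℤ) (B + 2); omega)
    (fun x hx h2 => by have := hB x hx h2; have := min_le_right (0 : ℤ) B; omega) hA


/-! ## §2 (QV) and (P̂V) for every `b` under `H(3)` -/


omit hp in
/-- `a_p(b) ≥ 0`: when the top block `b₀ − 2·bMin` reaches `p`, an index of the least parameter is counted among the partners. -/
theorem topPartners_nonneg (b : ℕ → ℤ) (p : ℕ) : 0 ≤ topPartners b p := by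
  unfold topPartners
  split_ifs with h
  · have hmem : bMin b ∈ (range 7).image fun i => b (i + 1) := Finset.min'_mem _ _
    obtain ⟨i₀, hi₀, hbi⟩ := mem_image.1 hmem
    have : 1 ≤ ((range 7).filter fun i => (p : ℤ) ≤ b 0 - b (i + 1) - bMin b).card :=
      card_pos.2 ⟨i₀, mem_filter.2 ⟨hi₀, by rw [hbi]; linarith⟩⟩
    omega
  · omega

omit hp in
/-- `refund ≤ refund_W` (`⌊d/p⌋ ≤ ⌊(d+1)/p⌋`). -/
theorem refund_le_refundW (b : ℕ → ℤ) {q : ℕ} (hq : 0 < q) : refund b q ≤ refundW b q := by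
  unfold refund refundW
  exact min_le_min le_rfl (Int.ediv_le_ediv (by exact_mod_cast hq) (by linarith))

/-- Under `H(3)`, `U(c)` is `p`-integral for `c = b` and `c = b + e_j`. -/
theorem coeffU_integral_of_goodClasses (b : ℕ → ℤ) {j : ℕ} (hb : InPolytope b) (hj1 : 1 ≤ j) (hb' : InPolytope (shift b j))
    (hp5 : 5 ≤ p) (hwin : (b 0 + 2 : ℤ) < (p : ℤ) ^ 2) (hgood : GoodClasses b p 3) :
    padicNorm p (coeffU b) ≤ (p : ℚ) ^ (-(0 : ℤ)) ∧ padicNorm p (coeffU (shift b j)) ≤ (p : ℚ) ^ (-(0 : ℤ)) := by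
  have hwin' : (shift b j 0 + 2 : ℤ) < (p : ℤ) ^ 2 := by rwa [shift_zero b hj1]
  have hum : ∀ x, x < p → 2 ≤ classPoleCount b p x → (0 : ℤ) ≤ 5 + classExp b p x :=
    fun x hx h2 => by have := hgood x hx h2; push_cast at this; omega
  have hcnt : ∀ x, classPoleCount (shift b j) p x ≤ classPoleCount b p x := fun x => classPoleCount_shift_le b hb.1 hj1 p x
  have hum' : ∀ x, x < p → 2 ≤ classPoleCount (shift b j) p x → (0 : ℤ) ≤ 5 + classExp (shift b j) p x :=
    fun x hx h2 => (hum x hx (le_trans h2 (hcnt x))).trans (by linarith [classExp_shift_ge b hb.1 hj1 p x])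
  exact ⟨coeffU_norm_le b hb hp5 hwin 0 le_rfl hum, coeffU_norm_le (shift b j) hb' hp5 hwin' 0 le_rfl hum'⟩

/-- **(QV) under `H(3)`, for every `b`**: `refund − N_p ≤ v_p(minorQ_j(b))`. -/
theorem qMinorLaw_of_goodClasses (b : ℕ → ℤ) {j : ℕ} (hb : InPolytope b) (hj1 : 1 ≤ j) (hj7 : j ≤ 7)
    (hb' : InPolytope (shift b j)) (hp5 : 5 ≤ p) (hwin : (b 0 + 2 : ℤ) < (p : ℤ) ^ 2) (hgood : GoodClasses b p 3)
    (hne : minorQ b j ≠ 0) : refund b p - pairFloors b p ≤ padicValRat p (minorQ b j) := by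
  have hp0 : 0 < p := hp.out.pos
  have hwin' : (shift b j 0 + 2 : ℤ) < (p : ℤ) ^ 2 := by rwa [shift_zero b hj1]
  obtain ⟨hU, hU'⟩ := coeffU_integral_of_goodClasses b hb hj1 hb' hp5 hwin hgood
  -- (WV) on `b` and on `b + e_j`, weakened to `refund(b) − N_p(b)`
  have hlaw : refund b p - pairFloors b p ≤ lawW b p := by
    unfold lawW; linarith [topPartners_nonneg b p, refund_le_refundW b hp0]
  have hlaw' : refund b p - pairFloors b p ≤ lawW (shift b j) p := by
    have hN' := pairFloors_shift_le b hj1 p hp0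
    have hr : refund b p ≤ refundW (shift b j) p := by
      unfold refund refundW; rw [dOf_shift b hj1 hj7, sub_add_cancel]
    unfold lawW; linarith [topPartners_nonneg (shift b j) p]
  have hW : padicNorm p (coeffW b) ≤ (p : ℚ) ^ (-(refund b p - pairFloors b p)) :=
    padicNorm_le_of_val fun hW0 => hlaw.trans (zeta3CoefficientValuationLaw_window b p hb hp.out hp5 hwin hW0)
  have hW' : padicNorm p (coeffW (shift b j)) ≤ (p : ℚ) ^ (-(refund b p - pairFloors b p)) :=
    padicNorm_le_of_val fun hW0 => hlaw'.trans (zeta3CoefficientValuationLaw_window (shift b j) p hb' hp.out hp5 hwin' hW0)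
  apply val_ge_of_padicNorm_le hne
  rw [minorQ, show -(refund b p - pairFloors b p) = -((0 : ℤ) + (refund b p - pairFloors b p)) by ring]
  exact minor_norm_le hU hU' hW hW'

/-- **(P̂V) under `H(3)`, for every `b`**: `refund − 1 − N_p ≤ v_p(minorPhat_j(b))`. -/
theorem phatMinorLaw_of_goodClasses (b : ℕ → ℤ) {j : ℕ} (hb : InPolytope b) (hj1 : 1 ≤ j)
    (hb' : InPolytope (shift b j)) (hp5 : 5 ≤ p) (hwin : (b 0 + 2 : ℤ) < (p : ℤ) ^ 2) (hgood : GoodClasses b p 3)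
    (hne : minorPhat b j ≠ 0) : refund b p - 1 - pairFloors b p ≤ padicValRat p (minorPhat b j) := by
  have hp0 : 0 < p := hp.out.pos
  have hp1 : (1 : ℚ) ≤ p := one_le_p
  have hwin' : (shift b j 0 + 2 : ℤ) < (p : ℤ) ^ 2 := by rwa [shift_zero b hj1]
  obtain ⟨hU, hU'⟩ := coeffU_integral_of_goodClasses b hb hj1 hb' hp5 hwin hgood
  have hN' := pairFloors_shift_le b hj1 p hp0
  have hV : padicNorm p (coeffV b) ≤ (p : ℚ) ^ (-(-pairFloors b p)) := by
    rw [neg_neg]; exact padicNorm_coeffV_le_pairFloors b hb hp5 hwin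
  have hV' : padicNorm p (coeffV (shift b j)) ≤ (p : ℚ) ^ (-(-pairFloors b p)) := by
    rw [neg_neg]
    exact (padicNorm_coeffV_le_pairFloors (shift b j) hb' hp5 hwin').trans (zpow_le_zpow_right₀ hp1 hN')
  have h := minor_norm_le hU hU' hV hV'
  have hr : refund b p ≤ 1 := min_le_left _ _
  apply val_ge_of_padicNorm_le hne
  rw [minorPhat]
  exact h.trans (zpow_le_zpow_right₀ hp1 (by linarith))

/-! ## §3 (QV) and (P̂V) for every `b` under the much weaker `H(6)` (every multipole class `E_x ≥ −5`)

The proofs of §2 use `H(3)` only through the `p`-integrality of `U(b)` and `U(b + e_j)`, which already holds under `H(6)`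
(`GoodClasses b p 6`: `6 + E_x ≥ 1` on multipole classes, i.e. `‖U_x‖ ≤ p^{−(5+E_x)} ≤ 1`); the `W`-side is the (WV) window theorem and the
`V`-side THEOREM V, both valid for EVERY `b`.  So the two minor laws are theorems for every `b` whose multipole classes all have `E_x ≥ −5`;
what remains OBSERVED of (QV)/(P̂V) is the deep regime `∃ x multipole, E_x ≤ −6`. -/

/-- Under `H(6)`, `U(c)` is `p`-integral for `c = b` and `c = b + e_j`. -/
theorem coeffU_integral_of_goodClasses6 (b : ℕ → ℤ) {j : ℕ} (hb : InPolytope b) (hj1 : 1 ≤ j) (hb' : InPolytope (shift b j))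
    (hp5 : 5 ≤ p) (hwin : (b 0 + 2 : ℤ) < (p : ℤ) ^ 2) (hgood : GoodClasses b p 6) :
    padicNorm p (coeffU b) ≤ (p : ℚ) ^ (-(0 : ℤ)) ∧ padicNorm p (coeffU (shift b j)) ≤ (p : ℚ) ^ (-(0 : ℤ)) := by
  have hwin' : (shift b j 0 + 2 : ℤ) < (p : ℤ) ^ 2 := by rwa [shift_zero b hj1]
  have hum : ∀ x, x < p → 2 ≤ classPoleCount b p x → (0 : ℤ) ≤ 5 + classExp b p x :=
    fun x hx h2 => by have := hgood x hx h2; push_cast at this; omega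
  have hcnt : ∀ x, classPoleCount (shift b j) p x ≤ classPoleCount b p x := fun x => classPoleCount_shift_le b hb.1 hj1 p x
  have hum' : ∀ x, x < p → 2 ≤ classPoleCount (shift b j) p x → (0 : ℤ) ≤ 5 + classExp (shift b j) p x :=
    fun x hx h2 => (hum x hx (le_trans h2 (hcnt x))).trans (by linarith [classExp_shift_ge b hb.1 hj1 p x])
  exact ⟨coeffU_norm_le b hb hp5 hwin 0 le_rfl hum, coeffU_norm_le (shift b j) hb' hp5 hwin' 0 le_rfl hum'⟩

/-- **(QV) under `H(6)`, for every `b`**: if every multipole class has `E_x ≥ −5` then `refund − N_p ≤ v_p(minorQ_j(b))`. -/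
theorem qMinorLaw_of_goodClasses6 (b : ℕ → ℤ) {j : ℕ} (hb : InPolytope b) (hj1 : 1 ≤ j) (hj7 : j ≤ 7)
    (hb' : InPolytope (shift b j)) (hp5 : 5 ≤ p) (hwin : (b 0 + 2 : ℤ) < (p : ℤ) ^ 2) (hgood : GoodClasses b p 6)
    (hne : minorQ b j ≠ 0) : refund b p - pairFloors b p ≤ padicValRat p (minorQ b j) := by
  have hp0 : 0 < p := hp.out.pos
  have hwin' : (shift b j 0 + 2 : ℤ) < (p : ℤ) ^ 2 := by rwa [shift_zero b hj1]
  obtain ⟨hU, hU'⟩ := coeffU_integral_of_goodClasses6 b hb hj1 hb' hp5 hwin hgood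
  have hlaw : refund b p - pairFloors b p ≤ lawW b p := by
    unfold lawW; linarith [topPartners_nonneg b p, refund_le_refundW b hp0]
  have hlaw' : refund b p - pairFloors b p ≤ lawW (shift b j) p := by
    have hN' := pairFloors_shift_le b hj1 p hp0
    have hr : refund b p ≤ refundW (shift b j) p := by
      unfold refund refundW; rw [dOf_shift b hj1 hj7, sub_add_cancel]
    unfold lawW; linarith [topPartners_nonneg (shift b j) p]
  have hW : padicNorm p (coeffW b) ≤ (p : ℚ) ^ (-(refund b p - pairFloors b p)) :=
    padicNorm_le_of_val fun hW0 => hlaw.trans (zeta3CoefficientValuationLaw_window b p hb hp.out hp5 hwin hW0)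
  have hW' : padicNorm p (coeffW (shift b j)) ≤ (p : ℚ) ^ (-(refund b p - pairFloors b p)) :=
    padicNorm_le_of_val fun hW0 => hlaw'.trans (zeta3CoefficientValuationLaw_window (shift b j) p hb' hp.out hp5 hwin' hW0)
  apply val_ge_of_padicNorm_le hne
  rw [minorQ, show -(refund b p - pairFloors b p) = -((0 : ℤ) + (refund b p - pairFloors b p)) by ring]
  exact minor_norm_le hU hU' hW hW'

/-- **(P̂V) under `H(6)`, for every `b`**: if every multipole class has `E_x ≥ −5` then `refund − 1 − N_p ≤ v_p(minorPhat_j(b))`. -/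
theorem phatMinorLaw_of_goodClasses6 (b : ℕ → ℤ) {j : ℕ} (hb : InPolytope b) (hj1 : 1 ≤ j)
    (hb' : InPolytope (shift b j)) (hp5 : 5 ≤ p) (hwin : (b 0 + 2 : ℤ) < (p : ℤ) ^ 2) (hgood : GoodClasses b p 6)
    (hne : minorPhat b j ≠ 0) : refund b p - 1 - pairFloors b p ≤ padicValRat p (minorPhat b j) := by
  have hp0 : 0 < p := hp.out.pos
  have hp1 : (1 : ℚ) ≤ p := one_le_p
  have hwin' : (shift b j 0 + 2 : ℤ) < (p : ℤ) ^ 2 := by rwa [shift_zero b hj1]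
  obtain ⟨hU, hU'⟩ := coeffU_integral_of_goodClasses6 b hb hj1 hb' hp5 hwin hgood
  have hN' := pairFloors_shift_le b hj1 p hp0
  have hV : padicNorm p (coeffV b) ≤ (p : ℚ) ^ (-(-pairFloors b p)) := by
    rw [neg_neg]; exact padicNorm_coeffV_le_pairFloors b hb hp5 hwin
  have hV' : padicNorm p (coeffV (shift b j)) ≤ (p : ℚ) ^ (-(-pairFloors b p)) := by
    rw [neg_neg]
    exact (padicNorm_coeffV_le_pairFloors (shift b j) hb' hp5 hwin').trans (zpow_le_zpow_right₀ hp1 hN')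
  have h := minor_norm_le hU hU' hV hV'
  have hr : refund b p ≤ 1 := min_le_left _ _
  apply val_ge_of_padicNorm_le hne
  rw [minorPhat]
  exact h.trans (zpow_le_zpow_right₀ hp1 (by linarith))

/-- `H(3) ⇒ H(6)`: §2 is the special case. -/
theorem goodClasses6_of_goodClasses3 (b : ℕ → ℤ) (p : ℕ) (h : GoodClasses b p 3) : GoodClasses b p 6 :=
  fun x hx h2 => by have := h x hx h2; push_cast at this ⊢; omega

end Summit.KontsevichZagierPeriods.Zeta5Search.ClusterValuation.MinorBounds
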